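import Summits.BirchSwinnertonDyer.Rank1Residual.GaloisImage.HauptmodulNineTower
import Summits.BirchSwinnertonDyer.Rank1Residual.GaloisImage.HauptmodulNineTowerThree
import Summits.BirchSwinnertonDyer.Rank1Residual.GaloisImage.HauptmodulNineTowerUnit
import Summits.BirchSwinnertonDyer.Rank1Residual.GaloisImage.HauptmodulNineTowerVZeroFour
import Summits.BirchSwinnertonDyer.Rank1Residual.GaloisImage.HauptmodulNineTowerThreeTwo
import Summits.BirchSwinnertonDyer.Rank1Residual.GaloisImage.HauptmodulExoticSignatureLemmas
import HarnessLib

/-!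
# THE EXOTIC SIGNATURE AFTER THE HAUPTMODUL ROUTE: a failing `3`-adic tower with `ρ̄_{E,3}` onto
# forces `v₃(j − 1728) ≤ 0` or one of five `(v₃(j), j/3^{v₃(j)} mod 9)` types — exactly the types
# with no prime of `ℚ(E[9]^{Stab C})` over `3` of ramification index divisible by `9`
# (cell `b2b-bsdres`, team n1011, seat p02 gen 6 — row T-b11-F4-END, file F4c-H26: the class END
# of rows T-b10 ARM A / T-b11-F4 in `j`-currency)

HONEST FRAMING (cell `b2b-bsdres`, run/shared/lean/b2b/bsd-rank1-residual/, verbatim in every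
file): the goal of the cell is to DELETE the COMBINATION-SHAPED residual classes of the
Birch–Swinnerton-Dyer formula for ALL analytic-rank `≤ 1` elliptic curves over `ℚ` — "full BSD
formula for every rank `≤ 1` curve in class `C`" assembled STRICTLY from published theorems — so
that the rank-`≤ 1` remainder becomes exactly the CONSTRUCTION-SHAPED classes, which are TYPED
(missing-input `Prop`s), NOT attempted. This is not "finishing BSD". Team n1011 (N10 / N11):
research route; no claim beyond the stated classes; labels UNCHANGED; nothing is booked. Theorems
only (no definition, no named fact).

## What this file proves

* **`exotic_hauptmodul_signature_of_not_towerSurj_three`** — for `E/ℚ` (any model) with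
  `ρ̄_{E,3}` onto and `ρ̄_{E,3ⁿ}` NOT onto for some `n`: either `v₃(j − 1728) ≤ 0`, or there are
  `V = v₃(j) ∈ ℕ` and `c ∈ ℤ` with `9 ∣ num(j/3^V − c)` (`K = j/3^V ≡ c (mod 9)`, `3 ∤ c`) and
  `(V, c mod 9)` in the list
  **`(3, 8)` · `(V ≡ 0 (mod 3), V ≥ 6; ±1)` · `(7; 2, 4)` · `(V ≢ 0 (mod 3), V ≥ 8; ±1)`**.
  Proof: `v₃(j − 1728) = 3` (T-b10 ARM A, `padicValRat_j_sub_eq_three_or_nonpos_of_not_towerSurj_three`),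
  `j ≠ 0` (`not_surj_three_of_j_eq_zero`), hence `V ≥ 3`; a residue `c` exists
  (`exists_nine_dvd_num_sub_of_padicValRat_eq_zero`); every other `(V, c mod 9)` is killed by a
  kernel tower theorem — `V = 3`: `c ≡ 1 (mod 3)` contradicts `v₃(j − 1728) = 3`, `c ≡ 2`
  `…TowerThreeTwo`, `c ≡ 5` `…TowerThree`; `V = 4` `HauptmodulNineTower`; `V = 5` `…TowerFive`;
  `V ≡ 0, ≥ 6`: `c ≡ ±2` `…TowerVZero`, `c ≡ ±4` `…TowerVZeroFour`; `V = 7`: `c ≡ ±1`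
  `…seven_pm`, `c ∈ {5, 7}` `…seven_e1`; `V ≡ 1, ≥ 10` `…vone`; `V ≡ 2, ≥ 8` `…vtwo`.
* `towerSurj_three_of_surj_of_not_signature` — contrapositive packaging for consumers: under
  surj(3) and `v₃(j − 1728) ≥ 1`, the tower holds UNLESS some residue `c` puts `(V, c mod 9)` in
  the signature.

READING (honest): the listed types are exactly those where the local analysis of the seat's notes
(`HOME/b2b-bsdres-n1011-p02/f4g6/UNIT-NORMALISATION-NOTE.md` §1) shows `Y³` is a cube in `ℚ₃(δ)`,
i.e. every prime of `ℚ(θ)` over `3` has `e·f ∈ {1, 2, 3, 6}` (kit j135556: 123/123 census cells of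
these types, incl. the 20 Elkies curves; kit j137075 controls) — so NO `Stab(C)`-invariant of a
cyclic `9`-group can certify the tower there: the inertia method ends here and the remaining cells
need global (Frobenius) input (p10's per-curve rows T-b11-TINST / -F4-H) or are genuinely exotic
(T-b11-ELK).  The theorem closes no class and books nothing; it NAMES the kernel's exotic residue at
`m = 3` in `(v₃(j), j/3^{v₃(j)} mod 9)`-currency.  X4 label UNCHANGED.

References: [SerreAbelianLadic1968] IV-23; [Maier2006] Table 4 (N = 3, 9), §5; [Elkies2006] §4;
[Kato2004Asterisque] (12.5.2).
-/

noncomputable section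

open scoped Classical

open WeierstrassCurve

namespace Summit.BirchSwinnertonDyer.Rank1Residual.GaloisImage

open Literature.NumberTheory.EllipticCurves

variable (W : WeierstrassCurve ℚ) [W.IsElliptic]

/-- **THE EXOTIC SIGNATURE AFTER THE HAUPTMODUL ROUTE.**  `E/ℚ` with `ρ̄_{E,3}` onto whose
`3`-adic tower fails has `v₃(j − 1728) ≤ 0`, or `v₃(j) = V` with `j/3^V ≡ c (mod 9)` and
`(V, c mod 9) ∈ {(3; 8), (3 ∣ V, V ≥ 6; 1, 8), (7; 2, 4), (3 ∤ V, V ≥ 8; 1, 8)}` — every other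
type carries a kernel tower theorem (T-b10 ARM A, T-b11-F4 gen 5/6).
[cite: SerreAbelianLadic1968, Ch. IV §3.4, Lemma 3 (IV-23)] [cite: Maier2006, Table 4 (N = 3, 9) and §5] -/
theorem exotic_hauptmodul_signature_of_not_towerSurj_three (hsurj : W.HasSurjectiveModNGaloisRep 3)
    (hnot : ¬ ∀ n : ℕ, W.HasSurjectiveModNGaloisRep (3 ^ n : ℕ)) :
    padicValRat 3 (W.j - 1728) ≤ 0 ∨
    ∃ (V : ℕ) (c : ℤ), padicValRat 3 W.j = V ∧ (9 : ℤ) ∣ (W.j / 3 ^ V - c).num ∧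
      ((V = 3 ∧ c % 9 = 8) ∨
       (6 ≤ V ∧ V % 3 = 0 ∧ (c % 9 = 1 ∨ c % 9 = 8)) ∨
       (V = 7 ∧ (c % 9 = 2 ∨ c % 9 = 4)) ∨
       (8 ≤ V ∧ V % 3 ≠ 0 ∧ (c % 9 = 1 ∨ c % 9 = 8))) := by
  haveI : Fact (Nat.Prime 3) := ⟨Nat.prime_three⟩
  rcases padicValRat_j_sub_eq_three_or_nonpos_of_not_towerSurj_three W hsurj hnot with hm3 | hle
  swap
  · exact Or.inl hle
  right
  have hj0 : W.j ≠ 0 := j_ne_zero_of_surj_three W hsurj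
  have hV3 : 3 ≤ padicValRat 3 W.j := three_le_padicValRat_of_padicValRat_sub_1728 hj0 hm3
  obtain ⟨V, hV⟩ : ∃ V : ℕ, padicValRat 3 W.j = V := ⟨(padicValRat 3 W.j).toNat, by omega⟩
  have hV3' : 3 ≤ V := by have h := hV3; rw [hV] at h; exact_mod_cast h
  -- the unit `K = j/3^V` and its residue `c`
  have h3 : (3 : ℚ) ≠ 0 := by norm_num
  have hK0 : W.j / 3 ^ V ≠ 0 := div_ne_zero hj0 (pow_ne_zero _ h3)
  have hKv : padicValRat 3 (W.j / 3 ^ V) = 0 := by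
    have h33 : padicValRat 3 (3 : ℚ) = 1 := by exact_mod_cast padicValRat.self (p := 3) (by norm_num)
    rw [padicValRat.div hj0 (pow_ne_zero _ h3), padicValRat.pow, hV, h33]
    all_goals norm_num
  obtain ⟨c, hc3, hc⟩ := exists_nine_dvd_num_sub_of_padicValRat_eq_zero hK0 hKv
  refine ⟨V, c, hV, hc, ?_⟩
  have hc9 : c % 9 = 1 ∨ c % 9 = 2 ∨ c % 9 = 4 ∨ c % 9 = 5 ∨ c % 9 = 7 ∨ c % 9 = 8 := by omega
  have conv : ∀ c' : ℤ, (9 : ℤ) ∣ c - c' → (9 : ℤ) ∣ (W.j / 3 ^ V - c').num :=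
    fun c' h ↦ nine_dvd_num_sub_of_dvd_sub hc h
  have hVcases : V = 3 ∨ V = 4 ∨ V = 5 ∨ (6 ≤ V ∧ V % 3 = 0) ∨ V = 7 ∨
      (8 ≤ V ∧ V % 3 = 1) ∨ (8 ≤ V ∧ V % 3 = 2) := by omega
  rcases hVcases with rfl | rfl | rfl | ⟨h6, h0⟩ | rfl | ⟨h8, h1⟩ | ⟨h8, h2⟩
  · -- `V = 3`: `c ≡ 1 (mod 3)` impossible; `c ≡ 2`, `5` covered; `c ≡ 8` is the signature
    have e27 : ∀ c' : ℤ, W.j / 3 ^ 3 - (c' : ℚ) = W.j / 27 - c' := fun c' ↦ by norm_num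
    rcases hc9 with h | h | h | h | h | h
    · exact absurd hm3 (padicValRat_sub_1728_ne_three_of_nine_dvd_num (q := W.j) (c := c)
        (by rw [← e27]; exact hc) (by omega))
    · have h' := conv 2 (by omega)
      rw [e27] at h'; push_cast at h'
      exact absurd (towerSurj_three_of_surj_of_nine_dvd_num_two W hsurj h') hnot
    · exact absurd hm3 (padicValRat_sub_1728_ne_three_of_nine_dvd_num (q := W.j) (c := c)
        (by rw [← e27]; exact hc) (by omega))
    · have h' := conv 5 (by omega)
      rw [e27] at h'; push_cast at h'
      exact absurd (towerSurj_three_of_surj_of_nine_dvd_num W hsurj h') hnot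
    · exact absurd hm3 (padicValRat_sub_1728_ne_three_of_nine_dvd_num (q := W.j) (c := c)
        (by rw [← e27]; exact hc) (by omega))
    · exact Or.inl ⟨rfl, h⟩
  · -- `V = 4`
    exact absurd (towerSurj_three_of_surj_of_padicValRat_j_eq_four W hsurj (by exact_mod_cast hV)) hnot
  · -- `V = 5`
    exact absurd (towerSurj_three_of_surj_of_padicValRat_j_eq_five W hsurj (by exact_mod_cast hV)) hnot
  · -- `V = 3k + 3 ≥ 6`
    obtain ⟨k, rfl⟩ : ∃ k, V = 3 * k + 3 := ⟨V / 3 - 1, by omega⟩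
    have hk1 : 1 ≤ k := by omega
    rcases hc9 with h | h | h | h | h | h
    · exact Or.inr (Or.inl ⟨h6, h0, Or.inl h⟩)
    · -- `c ≡ 2 = −2w₀`, `w₀ = −1`
      have h' := conv 2 (by omega)
      rw [show W.j / 3 ^ (3 * k + 3) - ((2 : ℤ) : ℚ) = W.j / 3 ^ (3 * k + 3) + 2 * ((-1 : ℤ) : ℚ) by
        push_cast; ring] at h'
      exact absurd (towerSurj_three_of_surj_of_nine_dvd_num_vzero W hsurj hk1 (w₀ := -1) (Or.inr rfl) h')
        hnot
    · -- `c ≡ 4 = 4w₀`, `w₀ = 1`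
      have h' := conv (4 * 1) (by omega)
      exact absurd (towerSurj_three_of_surj_of_nine_dvd_num_vzero_four W hsurj hk1 (w₀ := 1)
        (Or.inl rfl) h') hnot
    · -- `c ≡ 5 = 4w₀`, `w₀ = −1`
      have h' := conv (4 * (-1)) (by omega)
      exact absurd (towerSurj_three_of_surj_of_nine_dvd_num_vzero_four W hsurj hk1 (w₀ := -1)
        (Or.inr rfl) h') hnot
    · -- `c ≡ 7 = −2w₀`, `w₀ = 1`
      have h' := conv (-2) (by omega)
      rw [show W.j / 3 ^ (3 * k + 3) - ((-2 : ℤ) : ℚ) = W.j / 3 ^ (3 * k + 3) + 2 * ((1 : ℤ) : ℚ) by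
        push_cast; ring] at h'
      exact absurd (towerSurj_three_of_surj_of_nine_dvd_num_vzero W hsurj hk1 (w₀ := 1) (Or.inl rfl) h')
        hnot
    · exact Or.inr (Or.inl ⟨h6, h0, Or.inr h⟩)
  · -- `V = 7`
    rcases hc9 with h | h | h | h | h | h
    · exact absurd (towerSurj_three_of_surj_of_nine_dvd_num_seven_pm W hsurj (ε := 1) (Or.inl rfl)
        (conv 1 (by omega))) hnot
    · exact Or.inr (Or.inr (Or.inl ⟨rfl, Or.inl h⟩))
    · exact Or.inr (Or.inr (Or.inl ⟨rfl, Or.inr h⟩))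
    · exact absurd (towerSurj_three_of_surj_of_nine_dvd_num_seven_e1 W hsurj (ε := -1) (Or.inr rfl)
        (conv (-1 - 3) (by omega))) hnot
    · exact absurd (towerSurj_three_of_surj_of_nine_dvd_num_seven_e1 W hsurj (ε := 1) (Or.inl rfl)
        (conv (1 - 3) (by omega))) hnot
    · exact absurd (towerSurj_three_of_surj_of_nine_dvd_num_seven_pm W hsurj (ε := -1) (Or.inr rfl)
        (conv (-1) (by omega))) hnot
  · -- `V = 3k + 4 ≥ 10`
    obtain ⟨k, rfl⟩ : ∃ k, V = 3 * k + 4 := ⟨(V - 4) / 3, by omega⟩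
    have hk2 : 2 ≤ k := by omega
    rcases hc9 with h | h | h | h | h | h
    · exact Or.inr (Or.inr (Or.inr ⟨h8, by omega, Or.inl h⟩))
    · exact absurd (towerSurj_three_of_surj_of_nine_dvd_num_vone W hsurj hk2 (ε := -1) (e₁ := -1)
        (Or.inr rfl) (Or.inr rfl) (conv (-1 - 3 * (-1)) (by omega))) hnot
    · exact absurd (towerSurj_three_of_surj_of_nine_dvd_num_vone W hsurj hk2 (ε := 1) (e₁ := -1)
        (Or.inl rfl) (Or.inr rfl) (conv (1 - 3 * (-1)) (by omega))) hnot
    · exact absurd (towerSurj_three_of_surj_of_nine_dvd_num_vone W hsurj hk2 (ε := -1) (e₁ := 1)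
        (Or.inr rfl) (Or.inl rfl) (conv (-1 - 3 * 1) (by omega))) hnot
    · exact absurd (towerSurj_three_of_surj_of_nine_dvd_num_vone W hsurj hk2 (ε := 1) (e₁ := 1)
        (Or.inl rfl) (Or.inl rfl) (conv (1 - 3 * 1) (by omega))) hnot
    · exact Or.inr (Or.inr (Or.inr ⟨h8, by omega, Or.inr h⟩))
  · -- `V = 3k + 5 ≥ 8`
    obtain ⟨k, rfl⟩ : ∃ k, V = 3 * k + 5 := ⟨(V - 5) / 3, by omega⟩
    have hk1 : 1 ≤ k := by omega
    rcases hc9 with h | h | h | h | h | h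
    · exact Or.inr (Or.inr (Or.inr ⟨h8, by omega, Or.inl h⟩))
    · exact absurd (towerSurj_three_of_surj_of_nine_dvd_num_vtwo W hsurj hk1 (ε := -1) (e₁ := -1)
        (Or.inr rfl) (Or.inr rfl) (conv (-1 - 3 * (-1)) (by omega))) hnot
    · exact absurd (towerSurj_three_of_surj_of_nine_dvd_num_vtwo W hsurj hk1 (ε := 1) (e₁ := -1)
        (Or.inl rfl) (Or.inr rfl) (conv (1 - 3 * (-1)) (by omega))) hnot
    · exact absurd (towerSurj_three_of_surj_of_nine_dvd_num_vtwo W hsurj hk1 (ε := -1) (e₁ := 1)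
        (Or.inr rfl) (Or.inl rfl) (conv (-1 - 3 * 1) (by omega))) hnot
    · exact absurd (towerSurj_three_of_surj_of_nine_dvd_num_vtwo W hsurj hk1 (ε := 1) (e₁ := 1)
        (Or.inl rfl) (Or.inl rfl) (conv (1 - 3 * 1) (by omega))) hnot
    · exact Or.inr (Or.inr (Or.inr ⟨h8, by omega, Or.inr h⟩))

/-- **Contrapositive packaging: the `3`-adic tower from surj(3) OFF the exotic signature.**  If
`ρ̄_{E,3}` is onto, `v₃(j − 1728) ≥ 1`, and for `V = v₃(j)` and every `c` with `9 ∣ num(j/3^V − c)`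
the pair `(V, c mod 9)` is NOT of signature type, then `ρ̄_{E,3ⁿ}` is onto for every `n`.
[cite: SerreAbelianLadic1968, Ch. IV §3.4, Lemma 3 (IV-23)] [cite: Maier2006, Table 4 (N = 3, 9) and §5] -/
theorem towerSurj_three_of_surj_of_not_signature (hsurj : W.HasSurjectiveModNGaloisRep 3)
    (hpos : 0 < padicValRat 3 (W.j - 1728))
    (hsig : ∀ (V : ℕ) (c : ℤ), padicValRat 3 W.j = V → (9 : ℤ) ∣ (W.j / 3 ^ V - c).num →
      ¬ ((V = 3 ∧ c % 9 = 8) ∨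
         (6 ≤ V ∧ V % 3 = 0 ∧ (c % 9 = 1 ∨ c % 9 = 8)) ∨
         (V = 7 ∧ (c % 9 = 2 ∨ c % 9 = 4)) ∨
         (8 ≤ V ∧ V % 3 ≠ 0 ∧ (c % 9 = 1 ∨ c % 9 = 8))))
    (n : ℕ) : W.HasSurjectiveModNGaloisRep (3 ^ n : ℕ) := by
  by_contra hn
  have hnot : ¬ ∀ m : ℕ, W.HasSurjectiveModNGaloisRep (3 ^ m : ℕ) := fun h ↦ hn (h n)
  rcases exotic_hauptmodul_signature_of_not_towerSurj_three W hsurj hnot with hle | ⟨V, c, hV, hc, hs⟩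
  · exact absurd hpos (not_lt.mpr hle)
  · exact hsig V c hV hc hs

end Summit.BirchSwinnertonDyer.Rank1Residual.GaloisImage
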